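import Literature.AlgebraicGeometry.Motives.HodgeLieSymplecticBlocksProduct
import Summits.HodgeConjecture.CorCM.MumfordTateRankTypeOneRelDimTwoBlocks
import Summits.HodgeConjecture.CorCM.LefschetzAlgebraTotallyRealField
import Summits.HodgeConjecture.CorCM.MumfordTateRankOfPowers
import HarnessLib

/-!
# Real multiplication of relative dimension TWO, III: `Lie Hg(H¹B) ⊗ ℂ = ⊕_τ 𝔰𝔭(V_τ)`, `dim Lie Hg(H¹B) = 5 dim B`,
# `t = dim MT(H¹B) = 5 dim B + 1`, Hodge = Lefschetz (Moonen–Zarhin 1995: Type I(2), `Hg = R_{F/ℚ} Sp_{4,F}`)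

COR-CM (cell `pub-hodgecm2`, seat `b27` gen 46, count-neutral Mumford–Tate-rank ladder; theorems only, no definition, no named fact;
UNCONDITIONAL — nothing here uses or asserts HC_CM).  Third CorCM file of the rung (type I(e) with `m = 2`): a complex abelian variety
`B` whose endomorphism algebra is a TOTALLY REAL FIELD `E` of degree `e` with `dim B = 2e`.

§1 (abstract polarized weight-one Hodge structures with four-dimensional real eigenblocks `T_i`, `i ∈ ι` finite — the setting of the
Literature files `Motives/HodgeLieSymplecticBlocks{RankFour,Semisimple,Product}`) draws the consequences of the Goursat step
`SymplecticBlocks.exists_mem_hodgeLieC_supported` (lifts supported on one block):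
* **`SymplecticBlocks.mem_hodgeLieC_iff_of_rankFour`** — `Y ∈ Lie Hg ⊗ ℂ` iff `Y` preserves every block and is `ψ_ℂ`-skew, i.e.
  `Lie Hg ⊗ ℂ = ⊕_i 𝔰𝔭(T_i, ψ_ℂ|_{T_i})`;
* **`SymplecticBlocks.finrank_hodgeLieC_eq_of_rankFour`**, **`…finrank_hodgeLie_eq_of_rankFour`**, **`…mtRank_eq_of_rankFour`** —
  `dim Lie Hg ⊗ ℂ = dim_ℚ Lie Hg = 10 · #ι` (block restriction is a linear bijection onto `Π_i 𝔰𝔭(T_i)`, each `𝔰𝔭₄` of dimension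
  `4·5/2 = 10`, `Literature.Algebra.Lie.SymplecticDimension`) and `dim MT = 10 · #ι + 1`.

§2 reads this on `H¹(B)` (blocks `V_τ` over the `e` real embeddings `τ : E → ℂ`, four-dimensional by `dim B = 2e`):
* **`mem_hodgeLieC_hodge_one_iff_of_relDimTwo`** — `Lie Hg(H¹B) ⊗ ℂ = ⊕_τ 𝔰𝔭(V_τ)` («`Hg(B) = R_{E/ℚ} Sp_{4,E}`», Lie-algebra form);
* **`finrank_hodgeLie_hodge_one_of_relDimTwo`** — `dim_ℚ Lie Hg(H¹B) = 10e = 5 dim B`;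
* **`mtRank_hodge_one_of_relDimTwo`**, **`mtRank_hodge_one_of_relDimTwo'`** — `t = 5 dim B + 1` (the RUNG; primed form with an
  arbitrary smooth-projective witness, as used on the ladder);
* **`hodgeLie_hodge_one_eq_lefschetz_of_field_of_dim_eq_two_mul`** — Hodge = Lefschetz: `Lie Hg(H¹B) = C(End_Hdg(H¹B)) ∩ 𝔰𝔭(ψ)`
  (the criterion `hodgeLie_hodge_one_eq_lefschetz_iff_of_field` with `m = 2`: both sides have dimension `e · 2 · 5`);
* **`mtRank_hodge_one_of_isIsogenous_powSucc_relDimTwo`** — `X ∼ B^{m+1}` ⟹ `t(X) = 5 dim B + 1` (`Hg(Bⁿ) = Hg(B)`);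
* **`mtRank_hodge_one_of_fourfold_real_quadratic_field`** — the atlas row I(2) of Moonen–Zarhin 1995: an abelian FOURFOLD whose
  endomorphism algebra is a real quadratic field has `t = 21` and `dim Lie Hg(H¹B) = 20` (`Hg = R_{F/ℚ} Sp_{4,F}`).

So on the ladder, real multiplication of relative dimension two sits on the rung `t = 5g + 1` (`g = dim B = 2e`), between
`t = 3g + 1` (relative dimension one, `R_{E/ℚ} SL₂`) and the generic `t = g(2g+1)/e …`; compare Moonen–Zarhin's list for `g = 4`, `e = 2`:
`Hg = R_{F/ℚ} Sp_{4,F}` of dimension `20`, `t = 21`.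

## References
* [MoonenZarhin1995Duke] B. Moonen, Yu. G. Zarhin, *Hodge classes and Tate classes on simple abelian fourfolds*, Duke Math. J. 77
  (1995) 553–581 (Type I(2): `Hg = R_{F/ℚ} Sp_F(V, ψ)`).
* [MoonenZarhin1999LowDim] B. Moonen, Yu. G. Zarhin, Math. Ann. 315 (1999), §2 (2.2)–(2.3), §3 (3.1), Lemma (3.4).
* [Hazama1983] F. Hazama, Tôhoku Math. J. 35 (1983), Thm. (1.1), §3 pp. 305–306 (Goursat over the places; the count).
* [Ribet1983] K. A. Ribet, Amer. J. Math. 105 (1983), Thm. 0–1.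
* [Milne1999LefschetzClasses] J. S. Milne, Compositio Math. 117 (1999), §2, Prop. 4.8 (Lefschetz group of type I).
-/

noncomputable section

open scoped TensorProduct
open CategoryTheory Module NumberField

namespace Summit.HodgeConjecture.CorCM

open Literature.AlgebraicGeometry.Motives
open Literature.AlgebraicGeometry.Motives.AbelianVariety
open Literature.AlgebraicGeometry.Motives.HodgeStructure
open Literature.AlgebraicGeometry.HodgeTheory
open Literature.AlgebraicGeometry.ComplexMultiplication
open Literature.Algebra.Lie

/-! ## §1 Abstract form: `Lie Hg ⊗ ℂ = ⊕_i 𝔰𝔭(T_i)` and `dim = 10 · #ι` -/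

section Abstract

variable {V : Type} [AddCommGroup V] [Module ℚ V] [Module.Finite ℚ V] [HodgeTensorFacts.{0, 0}] {n : ℤ}
variable {ι : Type} [Fintype ι] [DecidableEq ι]

omit [Module.Finite ℚ V] [HodgeTensorFacts.{0, 0}] [Fintype ι] in
/-- Linear maps on `V_ℂ = ⊕_i T_i` agreeing on every block are equal. [folklore] -/
private theorem SymplecticBlocks.eq_of_forall_block (H : HodgeStructure V n) (σ : ι → (H.endAlg →+* ℂ))
    (hint : DirectSum.IsInternal fun i => H.eigenBlock (σ i)) {Y Y' : Module.End ℂ (ℂ ⊗[ℚ] V)}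
    (h : ∀ i, ∀ x ∈ H.eigenBlock (σ i), Y x = Y' x) : Y = Y' := by
  refine LinearMap.ext fun v => ?_
  have hv : v ∈ ⨆ i, H.eigenBlock (σ i) := by rw [hint.submodule_iSup_eq_top]; exact Submodule.mem_top
  exact Submodule.iSup_induction (fun i => H.eigenBlock (σ i)) (motive := fun v => Y v = Y' v) hv h
    (by rw [map_zero, map_zero]) fun x y hx hy => by rw [map_add, map_add, hx, hy]

omit [Module.Finite ℚ V] [HodgeTensorFacts.{0, 0}] [DecidableEq ι] in
/-- A sum of operators each supported on one block acts on `T_k` through the `k`-th summand. [folklore] -/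
private theorem SymplecticBlocks.sum_apply_of_supported (H : HodgeStructure V n) (σ : ι → (H.endAlg →+* ℂ))
    (L : ι → Module.End ℂ (ℂ ⊗[ℚ] V)) (hL0 : ∀ i j, j ≠ i → ∀ x ∈ H.eigenBlock (σ j), L i x = 0) (k : ι)
    {x : ℂ ⊗[ℚ] V} (hx : x ∈ H.eigenBlock (σ k)) : (∑ i, L i) x = L k x := by
  rw [LinearMap.sum_apply]
  exact Finset.sum_eq_single k (fun j _ hjk => hL0 j k (Ne.symm hjk) x hx) fun h => absurd (Finset.mem_univ k) h

/-- **`Lie Hg ⊗ ℂ = ⊕_i 𝔰𝔭(T_i, ψ_ℂ|_{T_i})` over four-dimensional real eigenblocks:** `Y ∈ Lie Hg(H) ⊗ ℂ` iff `Y` preserves every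
block `T_i` and is `ψ_ℂ`-skew («`Hg = R_{F/ℚ} Sp_{4,F}`», Moonen–Zarhin 1995 Type I(2); Hazama's Goursat argument over the places:
the supported lifts `SymplecticBlocks.exists_mem_hodgeLieC_supported` of the blocks of `Y` sum to `Y`).
[cite: MoonenZarhin1995Duke, Type I(2)] [cite: MoonenZarhin1999LowDim, §3 (3.1) and Lemma (3.4)] [cite: Hazama1983, §3 (pp. 305–306)] -/
theorem SymplecticBlocks.mem_hodgeLieC_iff_of_rankFour (H : HodgeStructure V n) (hn : n = 1) (heff : H.IsEffective)
    (ψ : H.Polarization)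
    (hself : ∀ a : H.endAlg, LinearMap.IsAdjointPair ψ.form ψ.form (a : Module.End ℚ V) (a : Module.End ℚ V))
    (σ : ι → (H.endAlg →+* ℂ)) (hreal : ∀ i, (starRingEnd ℂ).comp (σ i) = σ i)
    (hint : DirectSum.IsInternal fun i => H.eigenBlock (σ i)) (h4 : ∀ i, Module.finrank ℂ (H.eigenBlock (σ i)) = 4)
    (Y : Module.End ℂ (ℂ ⊗[ℚ] V)) :
    Y ∈ H.hodgeLieC ↔ (∀ i, ∀ x ∈ H.eigenBlock (σ i), Y x ∈ H.eigenBlock (σ i)) ∧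
      ∀ x y : ℂ ⊗[ℚ] V, ψ.form.baseChange ℂ (Y x) y + ψ.form.baseChange ℂ x (Y y) = 0 := by
  classical
  refine ⟨fun hY => ⟨fun i x hx => H.apply_mem_eigenBlock_of_mem_hodgeLieC hY hx, fun x y => by
    rw [formBaseChange_skew_of_mem_hodgeLieC ψ hY x y, neg_add_cancel]⟩, fun hY => ?_⟩
  obtain ⟨hmaps, hskew⟩ := hY
  -- supported lifts of the blocks of `Y`
  have hlift : ∀ i, ∃ Yi ∈ H.hodgeLieC, (∀ x ∈ H.eigenBlock (σ i), Yi x = Y x) ∧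
      ∀ j, j ≠ i → ∀ x ∈ H.eigenBlock (σ j), Yi x = 0 := by
    intro i
    obtain ⟨Yi, hYi, hYig, hYi0⟩ := SymplecticBlocks.exists_mem_hodgeLieC_supported H hn heff ψ hself σ hreal hint h4 i
      (Y.restrict (hmaps i)) (fun x y => by
        rw [LinearMap.coe_restrict_apply, LinearMap.coe_restrict_apply]; exact hskew x y)
    exact ⟨Yi, hYi, fun x hx => (hYig ⟨x, hx⟩).symm, hYi0⟩
  choose L hL hLeq hL0 using hlift
  have hsum : Y = ∑ i, L i :=
    SymplecticBlocks.eq_of_forall_block H σ hint fun k x hx => by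
      rw [SymplecticBlocks.sum_apply_of_supported H σ L hL0 k hx, hLeq k x hx]
  rw [hsum]
  exact Submodule.sum_mem _ fun i _ => hL i

/-- **`dim_ℂ (Lie Hg ⊗ ℂ) = 10 · #ι` over four-dimensional real eigenblocks** (`Lie Hg ⊗ ℂ = ⊕_i 𝔰𝔭(T_i)`, `dim 𝔰𝔭₄ = 10`): block
restriction is a linear bijection from `Lie Hg ⊗ ℂ` onto the families of `ψ_ℂ|_{T_i}`-skew operators (injective on block-preserving
operators; onto by the supported lifts), and `2 · dim 𝔰𝔭(T_i) = 4 · 5` (`SymplecticDimension.two_mul_finrank_skewAdjointSubmodule_of_flip_eq_neg`,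
the block forms being non-degenerate and alternating, `SymplecticBlocks.exists_blockData`).  Moonen–Zarhin: `dim R_{F/ℚ} Sp_{4,F} = 10[F:ℚ]`.
[cite: MoonenZarhin1995Duke, Type I(2)] [cite: Hazama1983, Thm. (1.1) and §3 (pp. 305–306)] -/
theorem SymplecticBlocks.finrank_hodgeLieC_eq_of_rankFour (H : HodgeStructure V n) (hn : n = 1) (heff : H.IsEffective)
    (ψ : H.Polarization)
    (hself : ∀ a : H.endAlg, LinearMap.IsAdjointPair ψ.form ψ.form (a : Module.End ℚ V) (a : Module.End ℚ V))
    (σ : ι → (H.endAlg →+* ℂ)) (hreal : ∀ i, (starRingEnd ℂ).comp (σ i) = σ i)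
    (hint : DirectSum.IsInternal fun i => H.eigenBlock (σ i)) (h4 : ∀ i, Module.finrank ℂ (H.eigenBlock (σ i)) = 4) :
    Module.finrank ℂ H.hodgeLieC = 10 * Fintype.card ι := by
  classical
  obtain ⟨Θ, hΘ⟩ := exists_hodgeTheta H
  have hYT : ∀ Y ∈ H.hodgeLieC, ∀ i, ∀ x ∈ H.eigenBlock (σ i), Y x ∈ H.eigenBlock (σ i) :=
    fun Y hY i x hx => H.apply_mem_eigenBlock_of_mem_hodgeLieC hY hx
  have hskew : ∀ Y ∈ H.hodgeLieC, ∀ x y, ψ.form.baseChange ℂ (Y x) y + ψ.form.baseChange ℂ x (Y y) = 0 :=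
    fun Y hY x y => by rw [formBaseChange_skew_of_mem_hodgeLieC ψ hY x y, neg_add_cancel]
  -- the block forms `ω_i = ψ_ℂ|_{T_i}` (opaque, with their defining equation)
  obtain ⟨ω, hω⟩ : ∃ ω : ∀ i, LinearMap.BilinForm ℂ ↥(H.eigenBlock (σ i)),
      ∀ i, ω i = (ψ.form.baseChange ℂ).compl₁₂ (H.eigenBlock (σ i)).subtype (H.eigenBlock (σ i)).subtype :=
    ⟨_, fun _ => rfl⟩
  have hω_apply : ∀ i (x y : H.eigenBlock (σ i)), ω i x y = ψ.form.baseChange ℂ (x : ℂ ⊗[ℚ] V) y := fun i x y => by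
    rw [hω i]; rfl
  have hmem : ∀ i (g : Module.End ℂ ↥(H.eigenBlock (σ i))), g ∈ (ω i).skewAdjointSubmodule ↔
      ∀ x y : H.eigenBlock (σ i), ψ.form.baseChange ℂ ((g x : H.eigenBlock (σ i)) : ℂ ⊗[ℚ] V) y +
        ψ.form.baseChange ℂ (x : ℂ ⊗[ℚ] V) ((g y : H.eigenBlock (σ i)) : ℂ ⊗[ℚ] V) = 0 := by
    intro i g
    rw [LinearMap.mem_skewAdjointSubmodule]
    simp only [LinearMap.IsSkewAdjoint, LinearMap.IsAdjointPair, Pi.neg_apply, hω_apply, Submodule.coe_neg, map_neg]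
    exact forall₂_congr fun x y => eq_neg_iff_add_eq_zero
  have hfin : ∀ i, Module.finrank ℂ (ω i).skewAdjointSubmodule = 10 := by
    intro i
    obtain ⟨hωnd, hωalt, -⟩ := SymplecticBlocks.exists_blockData H hn heff ψ hself σ hreal hint h4 hΘ i
    rw [← hω i] at hωnd hωalt
    have hflip : (ω i).flip = -ω i := LinearMap.ext fun x => LinearMap.ext fun y => by
      rw [LinearMap.BilinForm.flip_apply, LinearMap.neg_apply, LinearMap.neg_apply]; exact hωalt y x
    have h := SymplecticDimension.two_mul_finrank_skewAdjointSubmodule_of_flip_eq_neg (ω i) hωnd hflip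
    rw [h4 i] at h
    omega
  -- block restriction `c : Lie Hg ⊗ ℂ → Π_i 𝔰𝔭(T_i)`
  have hcmem : ∀ (Y : H.hodgeLieC) i,
      (Y : Module.End ℂ (ℂ ⊗[ℚ] V)).restrict (hYT Y Y.2 i) ∈ (ω i).skewAdjointSubmodule := fun Y i => by
    rw [hmem]
    intro x y
    rw [LinearMap.coe_restrict_apply, LinearMap.coe_restrict_apply]
    exact hskew Y Y.2 x y
  obtain ⟨c, hc⟩ : ∃ c : H.hodgeLieC →ₗ[ℂ] (∀ i, ↥((ω i).skewAdjointSubmodule)),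
      ∀ (Y : H.hodgeLieC) i (x : H.eigenBlock (σ i)),
        (((c Y i : Module.End ℂ ↥(H.eigenBlock (σ i))) x : H.eigenBlock (σ i)) : ℂ ⊗[ℚ] V) =
          (Y : Module.End ℂ (ℂ ⊗[ℚ] V)) x :=
    ⟨{ toFun := fun Y i => ⟨(Y : Module.End ℂ (ℂ ⊗[ℚ] V)).restrict (hYT Y Y.2 i), hcmem Y i⟩
       map_add' := fun Y Y' => funext fun i => Subtype.ext (LinearMap.ext fun x => Subtype.ext rfl)
       map_smul' := fun a Y => funext fun i => Subtype.ext (LinearMap.ext fun x => Subtype.ext rfl) },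
      fun Y i x => rfl⟩
  have hinj : Function.Injective c := by
    intro Y Y' h
    apply Subtype.ext
    refine SymplecticBlocks.eq_of_forall_block H σ hint fun k x hx => ?_
    have h1 := hc Y k ⟨x, hx⟩
    have h2 := hc Y' k ⟨x, hx⟩
    rw [h] at h1
    exact h1.symm.trans h2
  have hsurj : Function.Surjective c := by
    intro G
    have hlift : ∀ i, ∃ Yi ∈ H.hodgeLieC,
        (∀ x : H.eigenBlock (σ i), (((G i : Module.End ℂ ↥(H.eigenBlock (σ i))) x : H.eigenBlock (σ i)) : ℂ ⊗[ℚ] V) = Yi x) ∧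
          ∀ j, j ≠ i → ∀ x ∈ H.eigenBlock (σ j), Yi x = 0 := fun i =>
      SymplecticBlocks.exists_mem_hodgeLieC_supported H hn heff ψ hself σ hreal hint h4 i _ ((hmem i _).1 (G i).2)
    choose L hL hLeq hL0 using hlift
    refine ⟨⟨∑ i, L i, Submodule.sum_mem _ fun i _ => hL i⟩,
      funext fun i => Subtype.ext (LinearMap.ext fun x => Subtype.ext ?_)⟩
    rw [hc, hLeq i x]
    exact SymplecticBlocks.sum_apply_of_supported H σ L hL0 i x.2
  rw [(LinearEquiv.ofBijective c ⟨hinj, hsurj⟩).finrank_eq, Module.finrank_pi_fintype ℂ,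
    Finset.sum_congr rfl fun i _ => hfin i, Finset.sum_const, Finset.card_univ, smul_eq_mul, mul_comm]

/-- **`dim_ℚ Lie Hg(H) = 10 · #ι`** over four-dimensional real eigenblocks (`dim R_{F/ℚ} Sp_{4,F} = 10[F:ℚ]`).
[cite: MoonenZarhin1995Duke, Type I(2)] [cite: Hazama1983, Thm. (1.1) and §3 (pp. 305–306)] -/
theorem SymplecticBlocks.finrank_hodgeLie_eq_of_rankFour (H : HodgeStructure V n) (hn : n = 1) (heff : H.IsEffective)
    (ψ : H.Polarization)
    (hself : ∀ a : H.endAlg, LinearMap.IsAdjointPair ψ.form ψ.form (a : Module.End ℚ V) (a : Module.End ℚ V))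
    (σ : ι → (H.endAlg →+* ℂ)) (hreal : ∀ i, (starRingEnd ℂ).comp (σ i) = σ i)
    (hint : DirectSum.IsInternal fun i => H.eigenBlock (σ i)) (h4 : ∀ i, Module.finrank ℂ (H.eigenBlock (σ i)) = 4) :
    Module.finrank ℚ H.hodgeLie = 10 * Fintype.card ι := by
  rw [← finrank_hodgeLieC H]
  exact SymplecticBlocks.finrank_hodgeLieC_eq_of_rankFour H hn heff ψ hself σ hreal hint h4

/-- **`dim MT(H) = 10 · #ι + 1`** over four-dimensional real eigenblocks (`MT = 𝔾_m · R_{F/ℚ} Sp_{4,F}`; the tree's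
`mtRank_eq_finrank_hodgeLie_add_one`). [cite: MoonenZarhin1995Duke, Type I(2)] [cite: MoonenZarhin1999LowDim, §2 (2.2)] -/
theorem SymplecticBlocks.mtRank_eq_of_rankFour [Nontrivial V] (H : HodgeStructure V n) (hn : n = 1) (heff : H.IsEffective)
    (ψ : H.Polarization)
    (hself : ∀ a : H.endAlg, LinearMap.IsAdjointPair ψ.form ψ.form (a : Module.End ℚ V) (a : Module.End ℚ V))
    (σ : ι → (H.endAlg →+* ℂ)) (hreal : ∀ i, (starRingEnd ℂ).comp (σ i) = σ i)
    (hint : DirectSum.IsInternal fun i => H.eigenBlock (σ i)) (h4 : ∀ i, Module.finrank ℂ (H.eigenBlock (σ i)) = 4) :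
    H.mtRank = 10 * Fintype.card ι + 1 := by
  have hn0 : n ≠ 0 := by rw [hn]; exact one_ne_zero
  rw [mtRank_eq_finrank_hodgeLie_add_one H ψ hn0, SymplecticBlocks.finrank_hodgeLie_eq_of_rankFour H hn heff ψ hself σ hreal hint h4]

end Abstract

/-! ## §2 Abelian varieties with real multiplication of relative dimension two -/

variable [HodgeTensorFacts.{0, 0}] {B : AbelianVariety ℂ} (hF : IsField B.endAlgebra)

omit [HodgeTensorFacts.{0, 0}] in
/-- A number field has positive degree. [folklore] -/
private theorem finrank_pos_of_numberField₄ (E : Type*) [Field E] [NumberField E] : 0 < Module.finrank ℚ E :=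
  Module.finrank_pos

omit [HodgeTensorFacts.{0, 0}] in
include hF in
/-- `0 < dim B` when `dim B = 2[End⁰B : ℚ]` and `End⁰B` is a field. [folklore] -/
private theorem dim_pos_of_relDimTwo' (hdeg : B.dim = 2 * Module.finrank ℚ B.endAlgebra) : 0 < B.dim := by
  have h := finrank_pos_of_numberField₄ (EndField B hF)
  rw [EndField.finrank_eq hF] at h
  omega

/-- **`Lie Hg(H¹B) ⊗ ℂ = ⊕_τ 𝔰𝔭(V_τ, ψ_ℂ|_{V_τ})` for real multiplication of relative dimension two** (`End⁰B = E` a totally real field,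
`dim B = 2[E:ℚ]`): `Y ∈ Lie Hg(H¹B) ⊗ ℂ` iff `Y` preserves every block `V_τ` (`τ : E → ℂ`) and is `ψ_ℂ`-skew — the Lie-algebra form
of Moonen–Zarhin's «`Hg(B) = R_{E/ℚ} Sp_E(V, φ) ≅ R_{E/ℚ} Sp_{4,E}`» (Type I(2)). [cite: MoonenZarhin1995Duke, Type I(2)]
[cite: MoonenZarhin1999LowDim, §2 (2.2) and §3 (3.1)] [cite: Hazama1983, §3 (pp. 305–306)] -/
theorem mem_hodgeLieC_hodge_one_iff_of_relDimTwo (hHD : exists_isReal_hodgeModel) (hI : hodgePQ_independent_of_hodgeModel)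
    [IsTotallyReal (EndField B hF)] (hdeg : B.dim = 2 * Module.finrank ℚ B.endAlgebra) [Module.Finite ℚ (bettiCohomology B.X 1)]
    (ψ : (BettiUniverse.hodge hHD (AbelianVariety.isSmoothProjective_holds (A := B)) 1).Polarization)
    (Y : Module.End ℂ (ℂ ⊗[ℚ] bettiCohomology B.X 1)) :
    Y ∈ (BettiUniverse.hodge hHD (AbelianVariety.isSmoothProjective_holds (A := B)) 1).hodgeLieC ↔
      (∀ τ : EndField B hF →+* ℂ, ∀ x ∈ (BettiUniverse.hodge hHD (AbelianVariety.isSmoothProjective_holds (A := B)) 1).eigenBlock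
          (hodgeCharacter hF hHD hI τ),
        Y x ∈ (BettiUniverse.hodge hHD (AbelianVariety.isSmoothProjective_holds (A := B)) 1).eigenBlock (hodgeCharacter hF hHD hI τ)) ∧
      ∀ x y : ℂ ⊗[ℚ] bettiCohomology B.X 1, ψ.form.baseChange ℂ (Y x) y + ψ.form.baseChange ℂ x (Y y) = 0 := by
  classical
  have hB0 : 0 < B.dim := dim_pos_of_relDimTwo' hF hdeg
  have hX : IsSmoothProjective B.dim B.X := AbelianVariety.isSmoothProjective_holds
  exact SymplecticBlocks.mem_hodgeLieC_iff_of_rankFour _ Nat.cast_one (BettiUniverse.hodge_isEffective hHD hX 1) ψ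
    (isAdjointPair_self_of_isTotallyReal hF hHD hI hB0 ψ) (hodgeCharacter hF hHD hI) (hodgeCharacter_isReal hF hHD hI)
    (isInternal_eigenBlock_hodgeCharacter hF hHD hI) (finrank_eigenBlock_hodgeCharacter_eq_four hF hHD hI hdeg) Y

/-- **`dim_ℚ Lie Hg(H¹B) = 5 dim B` (`= 10e`) for real multiplication of relative dimension two** (`dim R_{E/ℚ} Sp_{4,E} = 10[E:ℚ]`).
[cite: MoonenZarhin1995Duke, Type I(2)] [cite: MoonenZarhin1999LowDim, §2 (2.2)] [cite: Hazama1983, Thm. (1.1) and §3 (pp. 305–306)] -/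
theorem finrank_hodgeLie_hodge_one_of_relDimTwo [Module.Finite ℚ (bettiCohomology B.X 1)] (hHD : exists_isReal_hodgeModel)
    (hI : hodgePQ_independent_of_hodgeModel) [IsTotallyReal (EndField B hF)] (hdeg : B.dim = 2 * Module.finrank ℚ B.endAlgebra) :
    Module.finrank ℚ (BettiUniverse.hodge hHD (AbelianVariety.isSmoothProjective_holds (A := B)) 1).hodgeLie = 5 * B.dim := by
  classical
  have hB0 : 0 < B.dim := dim_pos_of_relDimTwo' hF hdeg
  have hX : IsSmoothProjective B.dim B.X := AbelianVariety.isSmoothProjective_holds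
  obtain ⟨ψ⟩ := BettiUniverse.hodge_isPolarizable hHD (AbelianVariety.isSmoothProjective_holds (A := B)) 1
  have h := SymplecticBlocks.finrank_hodgeLie_eq_of_rankFour _ Nat.cast_one (BettiUniverse.hodge_isEffective hHD hX 1) ψ
    (isAdjointPair_self_of_isTotallyReal hF hHD hI hB0 ψ) (hodgeCharacter hF hHD hI) (hodgeCharacter_isReal hF hHD hI)
    (isInternal_eigenBlock_hodgeCharacter hF hHD hI) (finrank_eigenBlock_hodgeCharacter_eq_four hF hHD hI hdeg)
  rw [h, Embeddings.card, EndField.finrank_eq hF, hdeg]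
  ring

/-- **THE RUNG `t = dim MT(H¹B) = 5 dim B + 1` (`= 10e + 1`) for real multiplication of relative dimension two**
(`MT = 𝔾_m · R_{E/ℚ} Sp_{4,E}`). [cite: MoonenZarhin1995Duke, Type I(2)] [cite: MoonenZarhin1999LowDim, §2 (2.2)] -/
theorem mtRank_hodge_one_of_relDimTwo [Module.Finite ℚ (bettiCohomology B.X 1)] (hHD : exists_isReal_hodgeModel)
    (hI : hodgePQ_independent_of_hodgeModel) [IsTotallyReal (EndField B hF)] (hdeg : B.dim = 2 * Module.finrank ℚ B.endAlgebra) :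
    (BettiUniverse.hodge hHD (AbelianVariety.isSmoothProjective_holds (A := B)) 1).mtRank = 5 * B.dim + 1 := by
  classical
  have hB0 : 0 < B.dim := dim_pos_of_relDimTwo' hF hdeg
  haveI : Nontrivial (bettiCohomology B.X 1) := by
    apply Module.nontrivial_of_finrank_pos (R := ℚ)
    rw [finrank_bettiCohomology_one]
    omega
  obtain ⟨ψ⟩ := BettiUniverse.hodge_isPolarizable hHD (AbelianVariety.isSmoothProjective_holds (A := B)) 1
  rw [mtRank_eq_finrank_hodgeLie_add_one _ ψ (by norm_num), finrank_hodgeLie_hodge_one_of_relDimTwo hF hHD hI hdeg]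

/-- The rung with an arbitrary smooth-projective witness `hX : IsSmoothProjective n B.X` and the tree's model
`exists_isReal_hodgeModel_holds` (the form used on the Mumford–Tate rank ladder): `t = 5 dim B + 1 ∧ dim Lie Hg(H¹B) = 5 dim B`.
[cite: MoonenZarhin1995Duke, Type I(2)] [cite: MoonenZarhin1999LowDim, §2 (2.2)] -/
theorem mtRank_hodge_one_of_relDimTwo' {n : ℕ} (hX : IsSmoothProjective n B.X) [IsTotallyReal (EndField B hF)]
    (hdeg : B.dim = 2 * Module.finrank ℚ B.endAlgebra) :
    haveI := BettiUniverse.finite hX 1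
    (BettiUniverse.hodge exists_isReal_hodgeModel_holds hX 1).mtRank = 5 * B.dim + 1 ∧
      Module.finrank ℚ (BettiUniverse.hodge exists_isReal_hodgeModel_holds hX 1).hodgeLie = 5 * B.dim := by
  have hn : B.dim = n := schemeDim_eq_holds hX
  subst hn
  haveI := BettiUniverse.finite hX 1
  exact ⟨mtRank_hodge_one_of_relDimTwo hF exists_isReal_hodgeModel_holds hodgePQ_independent_of_hodgeModel_holds hdeg,
    finrank_hodgeLie_hodge_one_of_relDimTwo hF exists_isReal_hodgeModel_holds hodgePQ_independent_of_hodgeModel_holds hdeg⟩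

/-- **Hodge = Lefschetz for real multiplication of relative dimension two** (`End⁰B ≅ K` a totally real field, `dim B = 2[K:ℚ]`):
`Lie Hg(H¹B) = C(End_Hdg(H¹B)) ∩ 𝔰𝔭(ψ)`, both of dimension `10[K:ℚ]` — Moonen–Zarhin's `Hg(B) = R_{K/ℚ} Sp_{4,K} = Lef(B)` at the level
of Lie algebras, by the rung and the criterion `hodgeLie_hodge_one_eq_lefschetz_iff_of_field` (`m = 2`: `e · m(2m+1) = 10e`).
[cite: MoonenZarhin1995Duke, Type I(2)] [cite: Milne1999LefschetzClasses, §2, Prop. 4.8] [cite: Ribet1983, Thm. 0–1] -/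
theorem hodgeLie_hodge_one_eq_lefschetz_of_field_of_dim_eq_two_mul {B : AbelianVariety ℂ} {k : ℕ} (hB : IsSmoothProjective k B.X)
    {K : Type} [Field K] [NumberField K] [IsTotallyReal K] [Algebra K B.endAlgebra] [IsScalarTower ℚ K B.endAlgebra]
    (hK : Function.Bijective (algebraMap K B.endAlgebra)) (hBK : B.dim = 2 * Module.finrank ℚ K)
    [Module.Finite ℚ (bettiCohomology B.X 1)] (ψ : (BettiUniverse.hodge exists_isReal_hodgeModel_holds hB 1).Polarization) :
    (BettiUniverse.hodge exists_isReal_hodgeModel_holds hB 1).hodgeLie = Subalgebra.toSubmodule (Subalgebra.centralizer ℚ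
        ((BettiUniverse.hodge exists_isReal_hodgeModel_holds hB 1).endAlg : Set (Module.End ℚ (bettiCohomology B.X 1)))) ⊓
      ψ.form.skewAdjointSubmodule := by
  have hk : B.dim = k := schemeDim_eq_holds hB
  subst hk
  have hF : IsField B.endAlgebra :=
    MulEquiv.isField (Field.toIsField K) (RingEquiv.ofBijective (algebraMap K B.endAlgebra) hK).symm.toMulEquiv
  haveI : IsTotallyReal (EndField B hF) :=
    IsTotallyReal.ofRingEquiv ((RingEquiv.ofBijective (algebraMap K B.endAlgebra) hK).trans (EndField.toEndAlgebra hF).symm)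
  have hKE : Module.finrank ℚ K = Module.finrank ℚ B.endAlgebra :=
    (LinearEquiv.ofBijective ((Algebra.linearMap K B.endAlgebra).restrictScalars ℚ) hK).finrank_eq
  have hdeg : B.dim = 2 * Module.finrank ℚ B.endAlgebra := by rw [hBK, hKE]
  obtain ⟨-, h⟩ := mtRank_hodge_one_of_relDimTwo' hF hB hdeg
  refine (hodgeLie_hodge_one_eq_lefschetz_iff_of_field hB hK (m := 2) hBK ψ).2 ?_
  rw [h, hBK]
  ring

/-- **Powers: `X ∼ B^{m+1}` with `End⁰B` a totally real field of degree `dim B / 2` ⟹ `dim MT(H¹X) = 5 dim B + 1`**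
(`Hg(Bⁿ) = Hg(B)` acting diagonally, the tree's `mtRank_hodge_one_eq_of_isIsogenous_powSucc`). [cite: MoonenZarhin1999LowDim, §1 and §2 (2.2)]
[cite: MoonenZarhin1995Duke, Type I(2)] -/
theorem mtRank_hodge_one_of_isIsogenous_powSucc_relDimTwo {X : AbelianVariety ℂ} {n : ℕ} (hX : IsSmoothProjective n X.X)
    {k : ℕ} (hB : IsSmoothProjective k B.X) [IsTotallyReal (EndField B hF)] (hdeg : B.dim = 2 * Module.finrank ℚ B.endAlgebra)
    {m : ℕ} (hXB : IsIsogenous X (B.powSucc m)) :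
    haveI := BettiUniverse.finite hX 1
    (BettiUniverse.hodge exists_isReal_hodgeModel_holds hX 1).mtRank = 5 * B.dim + 1 := by
  rw [mtRank_hodge_one_eq_of_isIsogenous_powSucc hX hB (dim_pos_of_relDimTwo' hF hdeg) hXB]
  exact (mtRank_hodge_one_of_relDimTwo' hF hB hdeg).1

/-- **Moonen–Zarhin's row I(2) for fourfolds: an abelian FOURFOLD `B` whose endomorphism algebra is a real quadratic field has
`dim MT(H¹B) = 21` and `dim Lie Hg(H¹B) = 20`** (`Hg(B) = R_{F/ℚ} Sp_{4,F}` of dimension `2 · 10`; such `B` is simple of type I(2) with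
`m = 2`). [cite: MoonenZarhin1995Duke, Type I(2)] [cite: MoonenZarhin1999LowDim, §2 (2.2) and (2.4)] -/
theorem mtRank_hodge_one_of_fourfold_real_quadratic_field {n : ℕ} (hX : IsSmoothProjective n B.X) (hB4 : B.dim = 4)
    [IsTotallyReal (EndField B hF)] (hF2 : Module.finrank ℚ B.endAlgebra = 2) :
    haveI := BettiUniverse.finite hX 1
    (BettiUniverse.hodge exists_isReal_hodgeModel_holds hX 1).mtRank = 21 ∧
      Module.finrank ℚ (BettiUniverse.hodge exists_isReal_hodgeModel_holds hX 1).hodgeLie = 20 := by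
  have h := mtRank_hodge_one_of_relDimTwo' hF hX (by rw [hB4, hF2])
  rw [hB4] at h
  exact h

end Summit.HodgeConjecture.CorCM

end
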